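import Summits.BirchSwinnertonDyer.Rank1Residual.X11b.RouteR1OpenInputTight
import Summits.BirchSwinnertonDyer.Rank1Residual.X11b.ClassClosureTyped
import Summits.BirchSwinnertonDyer.Rank1Residual.X11b.RouteLoci
import HarnessLib

/-!
# X11b, route R1 — TRANSPORT: the cyclotomic lever (Skinner 2016 Thm. A + Stein–Wuthrich 2013
# Thm. 6.1 + Disegni 2020 Thm. 1) with ONE per-pair Schneider certificate FEEDS route R1's open input
# ((IMC)∘(BDP) at `𝟙` on the constructed `X_ac`) at the pair

HONEST FRAMING (cell `b2b-bsdres`, run/shared/lean/b2b/bsd-rank1-residual/, verbatim in every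
file): the goal of the cell is to DELETE the COMBINATION-SHAPED residual classes of the
Birch–Swinnerton-Dyer formula for ALL analytic-rank `≤ 1` elliptic curves over `ℚ` — "full BSD
formula for every rank `≤ 1` curve in class `C`" assembled STRICTLY from published theorems — so
that the rank-`≤ 1` remainder becomes exactly the CONSTRUCTION-SHAPED classes, which are TYPED
(missing-input `Prop`s), NOT attempted. This is not "finishing BSD". Sub-cell
`b2b-bsdres-multr1-p1` (X11b, route R1), gen 19; a RESEARCH ROUTE; no claim beyond the stated
class; X11b stays CONSTRUCTION-SHAPED; nothing here changes a label; nothing is booked; no named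
fact is minted (THEOREMS ONLY; no definition; no `sorry`). CONDITIONAL: every published / cited
named fact is a hypothesis, and the Schneider certificate `ClassClosure.RegulatorNonvanishingAt W p`
is a per-pair OPEN hypothesis (referee R133.2: certificate-shaped; class-wide it is Schneider's
conjecture, barrier `Literature/Barriers/BirchSwinnertonDyer/PAdicHeightNondegeneracy.lean`).

## What this file proves (gen 19)

`RouteR1OpenInputTight` (this gen) shows that on `R1Population ∩ {r_an = 1}` route R1's ONE open
input `R1OpenInputOnTreeAt W p` — the ANTICYCLOTOMIC (IMC)∘(BDP) identity at the trivial character,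
`ord_p f_ac(0) = 2·(ord_p log_{ω_E} P_K − 1)` for a generator of `Ch_Λ(X_ac(E[p^∞]))` on the
CONSTRUCTED module, at every Manin-good Heegner datum of every erratum field of the pair [erratum
Thm. 1.1 ⇐ FW21 Thm. 4.41, PREPRINT, ∘ Cas18 Thm. 3.2] — is EQUIVALENT to `BSD(E,p)` given the
route's published and cited facts. cc-typer-3's class-closure lever
(`ClassClosure.bsdp_of_leverLocus_of_regulatorNonvanishing`, `X11b/ClassClosureTyped.lean`) gives
`BSD(E,p)` on the lever's locus `Ram ∧ (split → 5 ≤ p)` from PUBLISHED facts — Skinner 2016 Thm. A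
(the CYCLOTOMIC main conjecture at `p ∥ N` under (irr) + (ram)), Stein–Wuthrich 2013 Thm. 6.1
(Jones's algebraic leading term), Disegni 2020 Thm. 1 (relative `p`-adic BSD in analytic rank one at
a multiplicative prime), GZK, modular parametrisation — plus ONE per-pair Schneider certificate
(non-vanishing of the canonical cyclotomic `p`-adic regulator). Every R1 pair is on that locus
(`R1Population.leverLocusAt`: a (ram) prime and `5 ≤ p`). Composing:

* `R1.openInputOnTreeAt_of_regulatorNonvanishing_of_control` — lever facts + the converse's facts
  (Skinner 2016 Thm. C, modularity, Cai–Shu–Tian 2014 Thm. 1.1) + the control shape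
  `R1ControlOnTreeAt W p` + the Schneider certificate ⟹ `R1OpenInputOnTreeAt W p`;
* **`R1.openInputOnTreeAt_of_regulatorNonvanishing_final`** — the same with the control shape
  DISCHARGED by the FIVE CITED facts of the gen-18 record (Poitou–Tate ×2, local Euler–Poincaré,
  `cd_p ≤ 2`, Brink 2007).

Reading: wherever a `p`-adic regulator certificate exists at an R1 pair (census: rmap-3 g6 `regjoin`,
cc-typer-3 REG-MULT, x11b3-p2 — numerical, EVIDENCE), the CYCLOTOMIC main conjecture TRANSPORTS to a
kernel-certified INSTANCE of the ANTICYCLOTOMIC main conjecture ∘ BDP formula at the trivial character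
on the constructed `X_ac(E[p^∞])` — i.e. of the erratum's Thm. 1.1 at `𝟙` / FW21 Thm. 4.41 at `𝟙`
for `f_E` — pair by pair. Nothing about FW21 is asserted; no label moves; the lever's own tier is the
referee's (R133.2).

References: [Skinner2016PacificMC] Thm. A, Thm. C; [SteinWuthrich2013] Thm. 6.1; [Disegni2020]
Thm. 1 (§1.2); [Castella2018] Thm. 2.3, Thm. 3.2, §5 (arXiv:1704.06608 pp. 5, 9, 12);
[Castella2018Erratum] Thm. 1.1 (p. 1); [CaiShuTian2014] Thm. 1.1; [Brink2007] Thm. 2 / Cor. 1;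
[Miller2011LMS] Def. 1.1. Cell record: HOME/b2b-bsdres-multr1-p1/REPORT.md §29.
-/

set_option autoImplicit false

noncomputable section

open scoped Classical

open WeierstrassCurve NumberField IsDedekindDomain Field
open Literature.NumberTheory.EllipticCurves Literature.NumberTheory.EllipticCurves.GreenbergSelmer
open Literature.NumberTheory.EllipticCurves.ModularForms
open Literature.NumberTheory.EllipticCurves.Rank1Residual
open Literature.NumberTheory.EllipticCurves.Rank1Residual.Typed
open Literature.NumberTheory.EllipticCurves.Castella2018
open Literature.NumberTheory.GaloisRepresentations
open Literature.NumberTheory.GaloisCohomology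
open Summit.BirchSwinnertonDyer.Rank1Residual.X11b.AcSelmer

namespace Summit.BirchSwinnertonDyer.Rank1Residual.X11b

/-! ### Transport: the cyclotomic lever (Skinner 2016 Thm. A + Stein–Wuthrich + Disegni) with a
per-pair Schneider certificate FEEDS the anticyclotomic open input -/

section Transport

variable (W : WeierstrassCurve ℚ) [W.IsElliptic] [W.IsGloballyMinimal] (p : ℕ) [Fact p.Prime]

omit [W.IsElliptic] in
/-- An R1 pair lies on the class-closure lever's locus: it has a (ram) prime (`ChainLocus.ram`) and
`5 ≤ p`. [cite: Skinner2016PacificMC, Thm. A (iii)] [cite: Disegni2020, Thm. 1 (§1.2), hypothesis (∗)] -/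
theorem R1Population.leverLocusAt (hW : R1Population W p) : ClassClosure.LeverLocusAt W p :=
  ClassClosure.leverLocusAt_of_ram_of_five_le W p hW.1.ram hW.1.1

/-- **THE CYCLOTOMIC LEVER FEEDS THE ANTICYCLOTOMIC OPEN INPUT (transport, per pair).** For `W/ℚ`
globally minimal elliptic and `p` on `R1Population` with `ord_{s=1} L(E,s) = 1`, given the control
shape `R1ControlOnTreeAt W p` and the PUBLISHED named facts of cc-typer-3's class-closure lever —
`hA` Skinner 2016 Thm. A (the CYCLOTOMIC main conjecture at `p ∥ N` under (irr) + (ram)), `hJn`/`hJs`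
Stein–Wuthrich 2013 Thm. 6.1 (Jones's algebraic leading term, non-split / split), `hHn`/`hHs`
(existence of the canonical `p`-adic height data), `hD` Disegni 2020 Thm. 1 (relative `p`-adic BSD in
analytic rank one at a multiplicative prime), `hGZK`, `hpar` (modular parametrisation) — and of §3's
converse (`hSk`, `hmod`, `hCST`): ONE per-pair Schneider certificate
`ClassClosure.RegulatorNonvanishingAt W p` (non-vanishing of the canonical cyclotomic `p`-adic
regulator; OPEN per pair, certificate-shaped, referee R133.2) implies `R1OpenInputOnTreeAt W p` — the
ANTICYCLOTOMIC (IMC)∘(BDP) identity at `𝟙`, `ord_p f_ac(0) = 2·(ord_p log_{ω_E} P_K − 1)` for a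
generator of `Ch_Λ(X_ac(E[p^∞]))`, on the CONSTRUCTED module at every R1 datum of the pair (erratum
Thm. 1.1 at the trivial character ∘ Cas18 Thm. 3.2, as a kernel-certified INSTANCE). Route: lever ⟹
`BSD(E,p)` (`ClassClosure.bsdp_of_leverLocus_of_regulatorNonvanishing`; an R1 pair is on the lever's
locus) ⟹ open input (§3). EVIDENCE for the open input pair by pair where a regulator certificate
exists; nothing about FW21 is asserted; no label moves.
[cite: Skinner2016PacificMC, Thm. A and Thm. C] [cite: SteinWuthrich2013, Thm. 6.1]
[cite: Disegni2020, Thm. 1 (§1.2)] [cite: Castella2018, Thm. 2.3, Thm. 3.2, §5 (arXiv:1704.06608 pp. 5, 9, 12)]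
[cite: Castella2018Erratum, Thm. 1.1 (p. 1)] -/
theorem R1.openInputOnTreeAt_of_regulatorNonvanishing_of_control
    (hA : Skinner2016.thmA_charIdeal_multiplicative)
    (hJn : SteinWuthrich2013.thm61_nonsplitMultiplicative)
    (hJs : SteinWuthrich2013.thm61_splitMultiplicative)
    (hHn : SteinWuthrich2013.exists_isMultCanonical)
    (hHs : SteinWuthrich2013.exists_isSplitMultCanonical)
    (hD : Disegni2020.thm1_padicBSD_rankOne_multiplicative)
    (hGZK : rank_eq_analyticRank_of_analyticRank_le_one) (hpar : nonempty_modularParametrizationData)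
    (hSk : Skinner2016.thmC_padicValRat_bsd_rank_zero) (hmod : exists_isNewformOf)
    (hCST : CaiShuTian2014.thm11_trivialChar)
    (hC : R1ControlOnTreeAt W p) (hW : R1Population W p) (hr : W.analyticRank = 1)
    (hReg : ClassClosure.RegulatorNonvanishingAt W p) : R1OpenInputOnTreeAt W p :=
  R1.openInputOnTreeAt_of_bsdp W p hGZK hSk hmod hCST hC hW.1
    (ClassClosure.bsdp_of_leverLocus_of_regulatorNonvanishing W p hA hJn hJs hHn hHs hD hGZK hpar
      (hW.classX11b hr) (R1Population.leverLocusAt W p hW) hReg)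

/-- **Transport OF RECORD: Schneider certificate ⟹ the anticyclotomic (IMC∘BDP)@`𝟙` instance, control
shape discharged by the five cited facts.** On `R1Population ∩ {r_an = 1}`: the lever's PUBLISHED
facts (Skinner 2016 Thm. A / Thm. C, Stein–Wuthrich 2013 Thm. 6.1, Disegni 2020 Thm. 1, GZK,
modularity, modular parametrisation, Cai–Shu–Tian 2014 Thm. 1.1), the FIVE CITED facts of the gen-18
record (which make (CTL) a tree theorem), and ONE per-pair Schneider certificate
`RegulatorNonvanishingAt W p` ⟹ `R1OpenInputOnTreeAt W p`. So every R1 pair carrying a `p`-adic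
regulator certificate carries a kernel-certified instance of the erratum's Thm. 1.1 at the trivial
character on the constructed `X_ac(E[p^∞])` (EVIDENCE for FW21 Thm. 4.41 at `𝟙`, pair by pair; the
certificates are numerical). CONDITIONAL; nothing booked; no label change.
[cite: Skinner2016PacificMC, Thm. A and Thm. C] [cite: SteinWuthrich2013, Thm. 6.1] [cite: Disegni2020, Thm. 1 (§1.2)]
[cite: Castella2018Erratum, Thm. 1.1 (p. 1)] [cite: Brink2007, Thm. 2 and Cor. 1] -/
theorem R1.openInputOnTreeAt_of_regulatorNonvanishing_final
    (hA : Skinner2016.thmA_charIdeal_multiplicative)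
    (hJn : SteinWuthrich2013.thm61_nonsplitMultiplicative)
    (hJs : SteinWuthrich2013.thm61_splitMultiplicative)
    (hHn : SteinWuthrich2013.exists_isMultCanonical)
    (hHs : SteinWuthrich2013.exists_isSplitMultCanonical)
    (hD : Disegni2020.thm1_padicBSD_rankOne_multiplicative)
    (hGZK : rank_eq_analyticRank_of_analyticRank_le_one) (hpar : nonempty_modularParametrizationData)
    (hSk : Skinner2016.thmC_padicValRat_bsd_rank_zero) (hmod : exists_isNewformOf)
    (hCST : CaiShuTian2014.thm11_trivialChar)
    (hPT : ∀ (K : Type) [Field K] [NumberField K], poitouTate_selmerStructure_duality K)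
    (hPT2 : ∀ (K : Type) [Field K] [NumberField K], poitouTate_sha_tateDual K)
    (hEP : ∀ (K : Type) [Field K] [NumberField K] (v : HeightOneSpectrum (𝓞 K)),
      localEulerPoincareCharacteristic (v.adicCompletion K))
    (hcd : fieldCdLE_two_of_numberField)
    (hBr : ∀ (K : Type) [Field K] [NumberField K] (p : ℕ) [Fact p.Prime],
      ZpExtension.decomp_not_le_kerSubgroup_of_isAnticyclotomic K p)
    (hW : R1Population W p) (hr : W.analyticRank = 1)
    (hReg : ClassClosure.RegulatorNonvanishingAt W p) : R1OpenInputOnTreeAt W p :=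
  R1.openInputOnTreeAt_of_regulatorNonvanishing_of_control W p hA hJn hJs hHn hHs hD hGZK hpar hSk
    hmod hCST
    (r1ControlOnTreeAt_of_poitouTateAtoms_of_anticyclotomicDecomposition W p hBr
      (r1PoitouTateAtomsAt_of_twoAtoms W p hPT hEP
        (r1TwoAtomsAt_of_baseSelmerCount W p hPT hPT2 hEP hcd
          (r1BaseSelmerCountAt_of_facts W p hGZK hmod hPT hEP))))
    hW hr hReg

end Transport

end Summit.BirchSwinnertonDyer.Rank1Residual.X11b

end
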